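import Mathlib
import HarnessLib
import HarnessLib.Audit
import Summits.CriticalPhenomena.Statement
import Summits.CriticalPhenomena.PercolationContinuityZ3.Theorems.PercLowPointHalfSpaceLowPointBookkeepingOfSharpStubs
import Summits.CriticalPhenomena.PercolationContinuityZ3.Theorems.PercLowPointHalfSpaceLowPointBookkeepingSharpReduce

namespace Summit.CriticalPhenomena.PercolationContinuityZ3.Theses.PercLowPointHalfSpace

open scoped BigOperators Topology Manifold Classical MeasureTheory ProbabilityTheory Matrix InnerProductSpace ComplexConjugate ContinuousMap
open Filter Set Function TopologicalSpace MeasureTheory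

/-- child 1 (A♯ₛ, four-neighbour form) -/
def BoundaryTwoArmSharpDiluted : Prop :=
  ∃ κ C : ℝ, 0 < κ ∧ ∀ s : unitInterval, ∀ e ∈ ({Pi.single 1 1, Pi.single 1 (-1), Pi.single 2 1, Pi.single 2 (-1)} : Finset (Literature.Probability.LatticeModels.Site 3)), ∀ r : ℕ, 1 ≤ r → (Literature.Probability.Percolation.floorDilutedPercolation 3 (Literature.Probability.Percolation.criticalProbI 3) s).real ({ω | ∃ y : Literature.Probability.LatticeModels.Site 3, (∃ i : Fin 3, (r : ℤ) ≤ |y i|) ∧ ω ∈ Literature.Probability.Percolation.openConnIn {x : Literature.Probability.LatticeModels.Site 3 | 0 ≤ x 0} 0 y} ∩ {ω | ∃ y : Literature.Probability.LatticeModels.Site 3, (∃ i : Fin 3, (r : ℤ) ≤ |y i - e i|) ∧ ω ∈ Literature.Probability.Percolation.openConnIn {x : Literature.Probability.LatticeModels.Site 3 | 0 ≤ x 0} e y} ∩ (Literature.Probability.Percolation.openConnIn {x : Literature.Probability.LatticeModels.Site 3 | 0 ≤ x 0} 0 e)ᶜ) ≤ C * (r : ℝ) ^ (-(11 / 4 +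 κ))

/-- child 2 (B♯, five half-boxes) -/
def NoFatHalfBoxes : Prop :=
  ∃ C : ℝ, 0 < C ∧ ∀ x ∈ insert (0 : Literature.Probability.LatticeModels.Site 3) ({Pi.single 1 1, Pi.single 1 (-1), Pi.single 2 1, Pi.single 2 (-1)} : Finset (Literature.Probability.LatticeModels.Site 3)), ∀ n : ℕ, 1 ≤ n → (Literature.Probability.Percolation.floorDilutedPercolation 3 (Literature.Probability.Percolation.criticalProbI 3) 1).real {ω | C * (n : ℝ) ^ ((11 : ℝ) / 4) ≤ (Literature.Probability.Percolation.clusterMaxIn (((Literature.Probability.LatticeModels.box 3 n).image fun y : Literature.Probability.LatticeModels.Site 3 => x + y).filter fun z : Literature.Probability.LatticeModels.Site 3 => 0 ≤ z 0) ω : ℝ)} ≤ Real.exp (-1)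

/-- the --glue-by decl has exactly the type Sub₁ → Sub₂ → K -/
theorem splitGlue_check : BoundaryTwoArmSharpDiluted → NoFatHalfBoxes → LowPointBookkeeping :=
  Summit.CriticalPhenomena.PercolationContinuityZ3.Theorems.FloorRusso.Glue.stub_glueConclusion

/-- syntactic-identity check: the glue decl's type is literally the arrow of the two bodies -/
example : (BoundaryTwoArmSharpDiluted → NoFatHalfBoxes → LowPointBookkeeping) =
    ((∃ κ C : ℝ, 0 < κ ∧ ∀ s : unitInterval, ∀ e ∈ ({Pi.single 1 1, Pi.single 1 (-1), Pi.single 2 1, Pi.single 2 (-1)} : Finset (Literature.Probability.LatticeModels.Site 3)), ∀ r : ℕ, 1 ≤ r → (Literature.Probability.Percolation.floorDilutedPercolation 3 (Literature.Probability.Percolation.criticalProbI 3) s).real ({ω | ∃ y : Literature.Probability.LatticeModels.Site 3, (∃ i : Fin 3, (r : ℤ) ≤ |y i|) ∧ ω ∈ Literature.Probability.Percolation.openConnIn {x : Literature.Probability.LatticeModels.Site 3 | 0 ≤ x 0} 0 y} ∩ {ω | ∃ y : Literature.Probability.LatticeModels.Site 3, (∃ i : Fin 3, (r : ℤ) ≤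 |y i - e i|) ∧ ω ∈ Literature.Probability.Percolation.openConnIn {x : Literature.Probability.LatticeModels.Site 3 | 0 ≤ x 0} e y} ∩ (Literature.Probability.Percolation.openConnIn {x : Literature.Probability.LatticeModels.Site 3 | 0 ≤ x 0} 0 e)ᶜ) ≤ C * (r : ℝ) ^ (-(11 / 4 + κ))) → (∃ C : ℝ, 0 < C ∧ ∀ x ∈ insert (0 : Literature.Probability.LatticeModels.Site 3) ({Pi.single 1 1, Pi.single 1 (-1), Pi.single 2 1, Pi.single 2 (-1)} : Finset (Literature.Probability.LatticeModels.Site 3)), ∀ n : ℕ, 1 ≤ n → (Literature.Probability.Percolation.floorDilutedPercolation 3 (Literature.Probability.Percolation.criticalProbI 3) 1).real {ω | C * (n : ℝ) ^ ((11 : ℝ) / 4) ≤ (Literature.Probability.Percolation.clusterMaxIn (((Literature.Probability.LatticeModels.box 3 n).image fun y : Literature.Probability.LatticeModels.Site 3 => x + y).filter fun z : Literature.Probability.LatticeModels.Site 3 => 0 ≤ z 0) ω : ℝ)} ≤ Real.exp (-1)) → LowPointBookkeeping) := rfl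

/-- the lead's canonical registered stubs imply the children in one line (landed Reduce.*) -/
example (h : ∃ κ C : ℝ, 0 < κ ∧ ∀ s : unitInterval, ∀ r : ℕ, 1 ≤ r → (Literature.Probability.Percolation.floorDilutedPercolation 3 (Literature.Probability.Percolation.criticalProbI 3) s).real ({ω | ∃ y : Literature.Probability.LatticeModels.Site 3, (∃ i : Fin 3, ((r : ℕ) : ℤ) ≤ |y i|) ∧ ω ∈ Literature.Probability.Percolation.openConnIn {x : Literature.Probability.LatticeModels.Site 3 | 0 ≤ x 0} 0 y} ∩ {ω | ∃ y : Literature.Probability.LatticeModels.Site 3, (∃ i : Fin 3, ((r : ℕ) : ℤ) ≤ |y i - (Pi.single 1 1 : Literature.Probability.LatticeModels.Site 3) i|) ∧ ω ∈ Literature.Probability.Percolation.openConnIn {x : Literature.Probability.LatticeModels.Site 3 | 0 ≤ x 0} (Pi.single 1 1) y} ∩ (Literature.Probability.Percolation.openConnIn {x : Literature.Probability.LatticeModels.Site 3 | 0 ≤ x 0} 0 (Pi.single 1 1))ᶜ) ≤ C * (r : ℝ) ^ (-(11 / 4 + κ))) :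
    BoundaryTwoArmSharpDiluted :=
  Summit.CriticalPhenomena.PercolationContinuityZ3.Theorems.FloorRusso.Reduce.twoArmSharpFloor_of_e1 h

example (h : ∃ C : ℝ, 0 < C ∧ ∀ n : ℕ, 1 ≤ n → (Literature.Probability.Percolation.floorDilutedPercolation 3 (Literature.Probability.Percolation.criticalProbI 3) 1).real {ω | C * (n : ℝ) ^ ((11 : ℝ) / 4) ≤ (Literature.Probability.Percolation.clusterMaxIn ((Literature.Probability.LatticeModels.box 3 n).filter fun z : Literature.Probability.LatticeModels.Site 3 => 0 ≤ z 0) ω : ℝ)} ≤ Real.exp (-1)) :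
    NoFatHalfBoxes :=
  Summit.CriticalPhenomena.PercolationContinuityZ3.Theorems.FloorRusso.Reduce.noFatHalfBox_of_origin h

/-- and conversely the children give the canonical stubs by instantiation -/
example (h : BoundaryTwoArmSharpDiluted) : ∃ κ C : ℝ, 0 < κ ∧ ∀ s : unitInterval, ∀ r : ℕ, 1 ≤ r → (Literature.Probability.Percolation.floorDilutedPercolation 3 (Literature.Probability.Percolation.criticalProbI 3) s).real ({ω | ∃ y : Literature.Probability.LatticeModels.Site 3, (∃ i : Fin 3, ((r : ℕ) : ℤ) ≤ |y i|) ∧ ω ∈ Literature.Probability.Percolation.openConnIn {x : Literature.Probability.LatticeModels.Site 3 | 0 ≤ x 0} 0 y} ∩ {ω | ∃ y : Literature.Probability.LatticeModels.Site 3, (∃ i : Fin 3, ((r : ℕ) : ℤ) ≤ |y i - (Pi.single 1 1 : Literature.Probability.LatticeModels.Site 3) i|) ∧ ω ∈ Literature.Probability.Percolation.openConnIn {x : Literature.Probability.LatticeModels.Site 3 | 0 ≤ x 0} (Pi.single 1 1) y} ∩ (Literature.Probability.Percolation.openConnIn {x : Literature.Probability.LatticeModels.Site 3 | 0 ≤ x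 0} 0 (Pi.single 1 1))ᶜ) ≤ C * (r : ℝ) ^ (-(11 / 4 + κ)) := by
  obtain ⟨κ, C, hκ, h⟩ := h
  exact ⟨κ, C, hκ, fun s r hr => h s (Pi.single 1 1) (by simp) r hr⟩

example (h : NoFatHalfBoxes) : ∃ C : ℝ, 0 < C ∧ ∀ n : ℕ, 1 ≤ n → (Literature.Probability.Percolation.floorDilutedPercolation 3 (Literature.Probability.Percolation.criticalProbI 3) 1).real {ω | C * (n : ℝ) ^ ((11 : ℝ) / 4) ≤ (Literature.Probability.Percolation.clusterMaxIn ((Literature.Probability.LatticeModels.box 3 n).filter fun z : Literature.Probability.LatticeModels.Site 3 => 0 ≤ z 0) ω : ℝ)} ≤ Real.exp (-1) := by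
  obtain ⟨C, hC, h⟩ := h
  refine ⟨C, hC, fun n hn => ?_⟩
  have h0 := h 0 (Finset.mem_insert_self _ _) n hn
  simpa only [zero_add, Finset.image_id'] using h0

end Summit.CriticalPhenomena.PercolationContinuityZ3.Theses.PercLowPointHalfSpace
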